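import Summits.QuantumFields.YangMills.Theorems.BalabanUVNodesN15DefectKernel
import Literature.MathematicalPhysics.QuantumFieldTheory.King1986.MinimizerTwoSpacing
import HarnessLib

/-!
# Route «BalabanUVNodes» (K4 «SpineRates»), node N15 = NE2, THE -a ∕ -b INTERFACE OF THE BACKGROUND LAYER, part 2∕2: KING'S SCALAR MINIMISER
# `a_kG_kQ_k^*` (Prop. 3.8 (3.71), first line) AS THE FIRST INHABITANT OF BINDER (a)'s FORMAT WITH A GENUINE TWO-LATTICE TRANSPORT

Cell `pub-ymgap`, seat `pub-ymgap-dag-n15-a` (KNIT-BY-NAME, generation g2; HUMAN RULING D-0062; chair R424 venue; `bears_on: R4∕N15`).  Filed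
`--supports stmt-QuantumFields-19351` until the node stub `S_N15` of route «BalabanUVNodes» is an item.  THEOREMS ONLY; imports BY NAME, nothing
in the tree modified: part 1∕2 `BalabanUVNodesN15DefectKernel` (this seat: `hasMaj_ofBlocks_of_entry_le`, `idef_id_pull_single_apply`),
`King1986.MinimizerTwoSpacing` (seat n18-b, Track-A node N18's printed model: `king_prop38_torus`, `king_prop38_torus_of_decay`),
`King1986.EffectiveLaplacianSymbol` (`minimiser`, `fineOp`, `Qmat`), `King1986.MinimizerAliasModes` (the closed constants `prop38RateConst`,
`prop38PosConst`, `lemma43Const`), `King1986.EffectiveLaplacianRate` (`aK` = (2.13)).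

WHY (the -a lane «vector layer by the scalar template», NODE-TABLE row n15).  The -b seat's background step
(`BalabanUVNodes.N15.BackgroundStep.idef_background_propagator_majorant`) consumes the `U ≡ 1` η-defect `𝔇(G₁′, G₁) = G₁′τ₁ − τ₂G₁` as a
source-weighted block majorant (binder (a)); part 1∕2 showed that a paired-point η-rate of King's SHAPE (3.73) on the matrix entries IS that binder.
The tree holds ONE printed-and-proved paired-point η-rate with a genuine two-lattice transport: King's Prop. 3.8 (3.71), first line, for his ACTUAL
`A = 0` block-spin minimisers `ℋ_k = a_kG^η_kQ^*_k` on the torus (n18-b's `king_prop38_torus`) — the scalar sibling of [Balaban1984PropagatorsI]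
(1.63)'s Landau-gauge minimiser `H_k`, whose two-spacing rate on the honest carrier is NOT PRINTED (the -a g0 site layer has it only in the
collapsed model, `NE2NodeTorus`).  This file puts King's theorem into binder (a)'s format BY NAME.

THE PRINT (King, CMP **102** (1986); a PROVED scalar `A = 0` statement, consumed through the tree theorem; nothing of [B5]∕[B9] asserted).  p. 664:
*«When x′ ∈ T_{η′}, we denote by x that point in T_η for which x′ ∈ B^n(x). Proposition 3.8. For x′, y′ ∈ T_{η′}, 0 < α < 1, and γ sufficiently
small, |a_{k+n}G^{η′}_{k+n}Q^*_{k+n}(x′, z) − a_kG^η_kQ^*_k(x, z)|, … ≦ CL^{−γk} exp[−δ₀{|x − z|, dist({x, y}, z)}]. (3.71)»*; p. 674: *«combining our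
bounds with Theorem 3.3 we deduce (3.71).»*

CONTENTS.
* `exists_kingProj` — King's pairing EXISTS as a map `Π ℤ∕(L^nL^kM_μ) → Π ℤ∕(L^kM_μ)`, `x_μ = ⌊x′_μ∕L^n⌋` (the binder `hpr` below is inhabited);
  `exists_minimiserLin` — `minimiser N M a c m²` IS a linear map of the unit-lattice field (the binders `hH`, `hH′` are inhabited).
* **`hasMaj_idef_kingMinimiser`** ⇐ `king_prop38_torus`: for `L` odd, `L ≥ 2`, `k, n ≥ 1`, `a, m² > 0`, `0 ≤ γ ≤ 1`, ANY [B6] site carrier `g`, ANY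
  site assignment `blk₁` of the unit torus `Ω = Π ℤ∕M_μ` with at most `n₀` points per cube and ANY `blk₂` of `T_{η′}`: `𝔇(ℋ_{k+n}, ℋ_k)` through
  (identity on unit-lattice sources, pull-back along `pr` on fine observations) has the CONSTANT block majorant `n₀(C₁ + C₂)L^{−γk}` between the
  sharp cube norms — uniformly in the volume, the mass and `n`; no exponential factor.
* **`hasMaj_idef_kingMinimiser_of_decay`** ⇐ `king_prop38_torus_of_decay`: modulo Theorem 3.3's decay of both kernels from the source cube (binders
  `hdecA`, `hdecB`, King's own input), the printed shape `n₀√(2c₀(C₁+C₂)L^{−γk})·e^{−(δ₀∕2)d(y,y′)}` — binder (a)'s `N_G(y,y′)·w(y′)` with the FLAT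
  weight (at unit-lattice sources the rate factor is the constant `θ^k`; n15-b's `…_flat` readings apply), `‖N_G‖_ρ` by part 1's `wrow_pairedRate`.

HONEST FRAMING ∕ LIMITS.  King's scalar `A = 0` MODEL (template literature; abelian Higgs, `d = 2, 3` as printed — the kernel theorem holds in every
`d ≥ 1`, odd `L ≥ 3`), NOT Bałaban's covariant∕vector objects; the exponential factor only through the decay binders; the operator is unit-lattice →
fine-lattice (the `H_k`∕`𝔊` shape), not the fine → fine propagator `G_k` of (3.42) — for the latter NO two-lattice η-rate is in the tree (King's Prop.
3.9 is typed abstractly in `King1986.SingleScaleRate`, its torus instance is not assembled).  Count-neutral (typed 28∕28 · discharged unchanged); NOT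
a discharge of N15; one finite T⁴ at fixed ε — NOT infinite volume, NOT OS on ℝ⁴, NOT a mass gap, NOT Clay.
-/

noncomputable section

namespace Summit.QuantumFields.YangMills.BalabanUVNodes.N15.DefectKernel

open Literature.MathematicalPhysics.QuantumFieldTheory.Balaban1983to89
open Literature.MathematicalPhysics.QuantumFieldTheory.Balaban1983to89.B11SectG (BlockNorm HasMaj)
open Literature.MathematicalPhysics.QuantumFieldTheory.Balaban1983to89.T4EtaRateDefect (idef)
open Literature.MathematicalPhysics.QuantumFieldTheory.Balaban1983to89.T4EtaRateCoeffDefect (pull fibre)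

/-! ## §5 (of the interface) The first inhabitant with a genuine two-lattice transport: King's scalar minimiser `a_kG_kQ_k^*` -/

section King

open Literature.MathematicalPhysics.QuantumFieldTheory.Balaban1983to89.B5Prop11Plancherel (Tor fine)
open Literature.MathematicalPhysics.QuantumFieldTheory.King1986 (aK prop38RateConst prop38PosConst lemma43Const)
open Literature.MathematicalPhysics.QuantumFieldTheory.King1986.Torus (minimiser fineOp Qmat king_prop38_torus
  king_prop38_torus_of_decay)

variable {d : ℕ}

/-- KING'S PAIRING «when x′ ∈ T_{η′}, we denote by x that point in T_η for which x′ ∈ B^n(x)» EXISTS as a map of the fine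
torus `Π ℤ∕(L^nL^kM_μ)` onto `Π ℤ∕(L^kM_μ)`: `x_μ = ⌊x′_μ ∕ L^n⌋` (the binder `hpr` of the theorems below is inhabited).
[cite: King1986, p.664 (before Prop. 3.8)] -/
theorem exists_kingProj (L : ℕ) [NeZero L] (k n : ℕ) (M : Fin d → ℕ) [hM : ∀ μ, NeZero (M μ)] :
    ∃ pr : Tor (fine (L ^ n * L ^ k) M) → Tor (fine (L ^ k) M), ∀ x' μ, (pr x' μ).val = (x' μ).val / L ^ n := by
  refine ⟨fun x' μ => (((x' μ).val / L ^ n : ℕ) : ZMod (fine (L ^ k) M μ)), fun x' μ => ?_⟩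
  have hlt : (x' μ).val < L ^ n * L ^ k * M μ := ZMod.val_lt (x' μ)
  have hdiv : (x' μ).val / L ^ n < L ^ k * M μ := Nat.div_lt_of_lt_mul (by rw [← mul_assoc]; exact hlt)
  show (((x' μ).val / L ^ n : ℕ) : ZMod (L ^ k * M μ)).val = (x' μ).val / L ^ n
  rw [ZMod.val_natCast, Nat.mod_eq_of_lt hdiv]

/-- King's minimiser kernel `ℋ = minimiser N M a c m²` (tree `King1986.EffectiveLaplacianSymbol`, a function of the unit-lattice
field) IS a linear map `(Tor M → ℝ) →ₗ (Tor (fine N M) → ℝ)` (the binders `hH`, `hH′` below are inhabited). [cite: King1986, (2.13)–(2.15) p.653] -/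
theorem exists_minimiserLin (N : ℕ) [NeZero N] (M : Fin d → ℕ) [hM : ∀ μ, NeZero (M μ)] (a c m2 : ℝ) :
    ∃ H : (Tor M → ℝ) →ₗ[ℝ] (Tor (fine N M) → ℝ), ∀ φ, H φ = minimiser N M a c m2 φ :=
  ⟨(a * (N : ℝ) ^ d) • (Matrix.mulVecLin (fineOp N M a c m2)⁻¹ ∘ₗ Matrix.mulVecLin (Qmat N M).transpose), fun φ => by
    simp only [LinearMap.smul_apply, LinearMap.comp_apply, Matrix.mulVecLin_apply]
    rfl⟩

/-- **KING'S PROPOSITION 3.8 (3.71), FIRST LINE, IN THE BLOCK-MAJORANT CURRENCY OF THE BACKGROUND STEP.**  For King's ACTUAL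
`A = 0` minimiser kernels `ℋ_k = a_kG^η_kQ^*_k` on `T_η = Π ℤ∕(L^kM_μ)` and `ℋ_{k+n}` on `T_{η′} = Π ℤ∕(L^nL^kM_μ)` over the SAME
unit torus `Ω = Π ℤ∕M_μ` (`L` odd, `L ≥ 2`, `k, n ≥ 1`, `a, m² > 0`; tree `King1986.MinimizerTwoSpacing.king_prop38_torus`, seat
n18-b), the η-defect through King's pairing `pr` (identity on unit-lattice sources, pull-back on fine observations) has, between
the sharp cube norms of ANY site assignment `blk₁` of `Ω` (at most `n₀` unit points per cube) and ANY `blk₂` of `T_{η′}`, the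
CONSTANT block majorant `n₀·(C₁ + C₂)·L^{−γk}` (`0 ≤ γ ≤ 1`) — uniformly in the volume, the mass and `n`.  The scalar TEMPLATE
of [B5] (1.63)'s `H_k` on the honest two-lattice carrier; no exponential factor (that is King's «combining our bounds with
Theorem 3.3», see `…_of_decay`). [cite: King1986, Prop. 3.8 (3.71) p.664; (4.19)–(4.31) pp.672–674] -/
theorem hasMaj_idef_kingMinimiser (hd : 0 < d) {L : ℕ} [NeZero L] (hLodd : Odd L) (hL : 2 ≤ L) {k n : ℕ}
    (hk : 1 ≤ k) (hn : 1 ≤ n) (M : Fin d → ℕ) [hM : ∀ μ, NeZero (M μ)] {a m2 : ℝ} (ha : 0 < a) (hm : 0 < m2)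
    {γ : ℝ} (hγ0 : 0 ≤ γ) (hγ1 : γ ≤ 1) {g : B6.Geometry} [DecidableEq g.Site] (blk₁ : Tor M → g.Site)
    (blk₂ : Tor (fine (L ^ n * L ^ k) M) → g.Site) {n₀ : ℕ} (hn₀ : ∀ y', (fibre blk₁ y').card ≤ n₀)
    (pr : Tor (fine (L ^ n * L ^ k) M) → Tor (fine (L ^ k) M)) (hpr : ∀ x' μ, (pr x' μ).val = (x' μ).val / L ^ n)
    (H : (Tor M → ℝ) →ₗ[ℝ] (Tor (fine (L ^ k) M) → ℝ))
    (hH : ∀ φ, H φ = minimiser (L ^ k) M (aK a L k) (((L ^ k : ℕ) : ℝ) ^ 2) m2 φ)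
    (H' : (Tor M → ℝ) →ₗ[ℝ] (Tor (fine (L ^ n * L ^ k) M) → ℝ))
    (hH' : ∀ φ, H' φ = minimiser (L ^ n * L ^ k) M (aK a L (k + n)) (((L ^ n * L ^ k : ℕ) : ℝ) ^ 2) m2 φ) :
    HasMaj (BlockNorm.ofBlocks g blk₁) (BlockNorm.ofBlocks g blk₂) (idef LinearMap.id (pull pr) H' H)
      (fun _ _ => n₀ * ((prop38RateConst a a (lemma43Const a L k n) ((Real.pi ^ 2 / 4) ^ d) d γ
        + prop38PosConst a ((Real.pi ^ 2 / 4) ^ d) d γ) * ((L ^ k : ℕ) : ℝ) ^ (-γ))) := by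
  have hent : ∀ (x' : Tor (fine (L ^ n * L ^ k) M)) (b : Tor M),
      |idef LinearMap.id (pull pr) H' H (Pi.single b 1) x'| ≤
        (prop38RateConst a a (lemma43Const a L k n) ((Real.pi ^ 2 / 4) ^ d) d γ
          + prop38PosConst a ((Real.pi ^ 2 / 4) ^ d) d γ) * ((L ^ k : ℕ) : ℝ) ^ (-γ) := by
    intro x' b
    rw [idef_id_pull_single_apply, hH', hH]
    exact king_prop38_torus hd hLodd hL hk hn M ha hm hγ0 hγ1 b (pr x') x' (hpr x')
  have h0 : (0 : ℝ) ≤ (prop38RateConst a a (lemma43Const a L k n) ((Real.pi ^ 2 / 4) ^ d) d γ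
      + prop38PosConst a ((Real.pi ^ 2 / 4) ^ d) d γ) * ((L ^ k : ℕ) : ℝ) ^ (-γ) :=
    (abs_nonneg _).trans (hent 0 0)
  exact hasMaj_ofBlocks_of_entry_le blk₁ blk₂ (κ := fun _ _ => _) (fun _ _ => h0) hn₀ hent

/-- **… WITH THE EXPONENTIAL FACTOR, modulo Theorem 3.3's decay** (`king_prop38_torus_of_decay`): if both minimiser kernels
decay from the source cube, `|ℋ(δ_b)(·)| ≤ c₀e^{−δ₀d(blk₂x′, blk₁b)}` at the point pair (King's input «Theorem 3.3», a binder),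
the defect has the block majorant `n₀·√(2c₀(C₁+C₂)L^{−γk})·e^{−(δ₀∕2)d(y,y′)}` — the printed shape `CL^{−γ′k}e^{−δ₀′|x−z|}`
of (3.71) (`γ′ = γ∕2`, `δ₀′ = δ₀∕2`) as a `B11SectG.HasMaj` statement, i.e. binder (a)'s format with the flat weight.
[cite: King1986, Prop. 3.8 (3.71) p.664 + p.674 «combining our bounds with Theorem 3.3»] -/
theorem hasMaj_idef_kingMinimiser_of_decay (hd : 0 < d) {L : ℕ} [NeZero L] (hLodd : Odd L) (hL : 2 ≤ L)
    {k n : ℕ} (hk : 1 ≤ k) (hn : 1 ≤ n) (M : Fin d → ℕ) [hM : ∀ μ, NeZero (M μ)] {a m2 : ℝ} (ha : 0 < a)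
    (hm : 0 < m2) {γ : ℝ} (hγ0 : 0 ≤ γ) (hγ1 : γ ≤ 1) {g : B6.Geometry} [DecidableEq g.Site]
    (blk₁ : Tor M → g.Site) (blk₂ : Tor (fine (L ^ n * L ^ k) M) → g.Site) {n₀ : ℕ}
    (hn₀ : ∀ y', (fibre blk₁ y').card ≤ n₀)
    (pr : Tor (fine (L ^ n * L ^ k) M) → Tor (fine (L ^ k) M)) (hpr : ∀ x' μ, (pr x' μ).val = (x' μ).val / L ^ n)
    (H : (Tor M → ℝ) →ₗ[ℝ] (Tor (fine (L ^ k) M) → ℝ))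
    (hH : ∀ φ, H φ = minimiser (L ^ k) M (aK a L k) (((L ^ k : ℕ) : ℝ) ^ 2) m2 φ)
    (H' : (Tor M → ℝ) →ₗ[ℝ] (Tor (fine (L ^ n * L ^ k) M) → ℝ))
    (hH' : ∀ φ, H' φ = minimiser (L ^ n * L ^ k) M (aK a L (k + n)) (((L ^ n * L ^ k : ℕ) : ℝ) ^ 2) m2 φ)
    {c₀ δ₀ : ℝ}
    (hdecA : ∀ (b : Tor M) (x' : Tor (fine (L ^ n * L ^ k) M)),
      |H (Pi.single b 1) (pr x')| ≤ c₀ * Real.exp (-(δ₀ * g.dist (blk₂ x') (blk₁ b))))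
    (hdecB : ∀ (b : Tor M) (x' : Tor (fine (L ^ n * L ^ k) M)),
      |H' (Pi.single b 1) x'| ≤ c₀ * Real.exp (-(δ₀ * g.dist (blk₂ x') (blk₁ b)))) :
    HasMaj (BlockNorm.ofBlocks g blk₁) (BlockNorm.ofBlocks g blk₂) (idef LinearMap.id (pull pr) H' H)
      (fun y y' => n₀ * (Real.sqrt ((prop38RateConst a a (lemma43Const a L k n) ((Real.pi ^ 2 / 4) ^ d) d γ
          + prop38PosConst a ((Real.pi ^ 2 / 4) ^ d) d γ) * ((L ^ k : ℕ) : ℝ) ^ (-γ) * (2 * c₀))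
        * Real.exp (-(δ₀ / 2 * g.dist y y')))) := by
  refine hasMaj_ofBlocks_of_entry_le blk₁ blk₂ (κ := fun y y' => Real.sqrt _ * Real.exp (-(δ₀ / 2 * g.dist y y')))
    (fun _ _ => mul_nonneg (Real.sqrt_nonneg _) (Real.exp_nonneg _)) hn₀ fun x' b => ?_
  rw [idef_id_pull_single_apply, hH', hH]
  have hA := hdecA b x'
  have hB := hdecB b x'
  rw [hH] at hA
  rw [hH'] at hB
  exact king_prop38_torus_of_decay hd hLodd hL hk hn M ha hm hγ0 hγ1 b (pr x') x' (hpr x') hA hB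

end King

end Summit.QuantumFields.YangMills.BalabanUVNodes.N15.DefectKernel
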